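import Literature.RepresentationTheory.MoeglinVignerasWaldspurger1987.RankOneOscillatorMultiplicityOne
import Literature.RepresentationTheory.TwistedCoinvariantsTypePeriodicity
import HarnessLib

/-!
# Rank `1 × 1` non-periodicity from the torus character: the assembly (M4) of the character route to row IV-4(c3)
# `rankOne_theta_twist_rigidity`

Topic `RepresentationTheory/MoeglinVignerasWaldspurger1987`; namespace
`Literature.RepresentationTheory.MoeglinVignerasWaldspurger1987`.  THEOREMS ONLY (no definition, no named fact, no
`sorry`).  Cell `hodgecm-mathlib`, crux HD3 (`stmt-HodgeConjecture-24837`); the binder `hD3` rests on row IV-4(c3)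
`rankOne_theta_twist_rigidity` alone (`HCCMUnconditionalHD3OfTwistRigidity.lean`), and route R
(`RankOneThetaLiftTwistRigidityOfNonPeriodic.lean`, `rankOne_theta_twist_rigidity_of_nonPeriodic₁₁ (hNP) (hframe) (hblock)`)
reduces that row to the single statement `hNP` — **rank `1 × 1` non-periodicity**: for a `1 × 1` Gram matrix `t`, a
non-split place `v`, a section `s₁ : U(J₁)(F_v) →* S̃p(𝕎_v)` over `ι_v` with `ω_{s₁}` smooth and a character `η₁` of the
compact torus `U(J₁)(F_v) = E_v¹` with open kernel, if the TYPE SET `{ξ : Coinv_ξ(ω_{s₁}) ≠ 0}` of the `(U(1), U(1))`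
oscillator representation is invariant under `ξ ↦ ξ · η₁`, then `η₁ = 1`.

This file ASSEMBLES `hNP` (CHARACTER ROUTE, cell bus 2026-08-28 05:2x–05:5xZ, arbiter-signed texts) from:

* **(M1)** multiplicity one of the `(U(1), U(1))` oscillator types (`finiteDimensional_weightSpace_rankOne`,
  `RankOneOscillatorMultiplicityOne.lean`; [MVW87, Chap. 3 §IV.4 Thm. principal 1) a)] at `N = 1`);
* **(M2)** the finite-level trace identity for a smooth representation of a compact abelian group with multiplicity-free
  types and its VANISHING under a period of the type set
  (`TwistedCoinv.trace_fixedPoints_eq_zero_of_coinv_periodic'`, `TwistedCoinvariantsTypePeriodicity.lean`: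
  `tr(ω(t) | Fix_K) = Σ_ξ dim(ω_ξ) ξ(t)` and `Σ_ξ ξ(t)` over an `η`-stable set vanishes when `η(t) ≠ 1`, `K ≤ ker η`);
* **(TR)** the FINITE-LEVEL CHARACTER NON-VANISHING of the oscillator representation on the torus — for `z₀ ∈ E_v¹` with
  `z₀² ≠ 1` (Weil's big cell) and every small open `K`, `tr(ω_{s₁}(z₀) | Fix_K) ≠ 0` (its value is the Weil-index
  phase times `|N_{E/F}(1 - z₀)|_v^{-1/2}` up to normalisation: Howe's character formula read at finite level from the
  Schrödinger kernels, [Howe1973]; [MoeglinVignerasWaldspurger1987, Chap. 2 II]; [Thomas2008, Thm. 1C]) — carried here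
  as the HYPOTHESIS `hTR` in the exact text of the cell's TR theorem `rankOne_torusTrace_ne_zero`
  (`∃ K₀` open, `∀` open `K ≤ K₀`, `∀ W` finite-dimensional with `f ∈ W ↔ ∀ k ∈ K, ω k f = f`, the trace of
  `ω_{s₁}(z₀)|_W` is `≠ 0`), to be discharged BY NAME when that theorem lands;
* admissibility of `ω_{s₁}` at a non-split place (`isAdmissible_weil_localPi_of_isField`: `Fix_K` is finite-dimensional),
  commutativity and compactness of `U(J₁)(F_v)` (`localPi_one_mul_comm`, `compactSpace_localPi_rankOne`).

Proof of `nonPeriodic₁₁_of_torusTrace` (§2): if `η₁ ≠ 1`, pick `z₀` with `η₁ z₀ ≠ 1` AND `z₀² ≠ 1` (§1: in a commutative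
group with one element off `{z : z² = 1}`, a non-trivial character is non-trivial at such an element — if every
`η₁`-bad point squared to `1` so would every `η₁`-good one); let `K₀` be TR's level at `z₀` and `K := K₀ ⊓ ker η₁`
(open); on `W := Fix_K(ω_{s₁})` (finite-dimensional, `ω_{s₁}(z₀)`-stable by commutativity) TR gives `tr ≠ 0` and (M2),
fed with (M1), gives `tr = 0`.  §3: row IV-4(c3) modulo `hTR` and the route-R frame inputs.

HC_CM is NOT proved here: this file makes the residual of row IV-4(c3) the single finite-level character statement `hTR`;
HC_CM is proved only modulo the 7 printed citations until rung 0 of the ladder closes.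

## References
* [MoeglinVignerasWaldspurger1987] C. Mœglin, M.-F. Vignéras, J.-L. Waldspurger, LNM 1291 (1987), Chap. 2 II.1–II.8,
  Chap. 3 §IV.4 Théorème principal 1) a).
* [Howe1973] R. Howe, On the character of Weil's representation, Trans. AMS 177 (1973) 287–298.
* [Thomas2008] T. Thomas, The character of the Weil representation, J. LMS 77 (2008), Thm. 1C.
* [BernsteinZelevinsky1976] I. N. Bernstein, A. V. Zelevinsky, Russian Math. Surveys 31 (1976), §2.1–2.3.
* [Liu2021] Y. Liu, Camb. J. Math. 9 (2021), App. D Lem. D.1 (3).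
-/

set_option autoImplicit false

noncomputable section

open NumberField IsDedekindDomain Matrix
open scoped Matrix MatrixGroups
open Literature.RepresentationTheory Literature.RepresentationTheory.HeisenbergGroup
open Literature.NumberTheory.GelbartRogawski1991.UnitaryDualPair.LocalSplitting
open Literature.NumberTheory.GelbartRogawski1991.UnitaryDualPair.LocalSplitting.BlockSum
open Literature.NumberTheory.Automorphic Literature.NumberTheory.Automorphic.UnitaryGroup
open Literature.NumberTheory.Automorphic.Liu2021

namespace Literature.RepresentationTheory.MoeglinVignerasWaldspurger1987

/-! ## §1 The choice of the test element -/

/-- **choice of the test element**: in a group whose elements commute and which has an element off `{z : z² = 1}`, a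
non-trivial homomorphism `η` is non-trivial at some `z₀` with `z₀² ≠ 1` — if every `η`-bad point squared to `1`, so
would every `η`-good point `w` (as `z₁ w` is bad for a bad `z₁`), i.e. every square would be trivial. [folklore] -/
private theorem exists_map_ne_one_and_mul_self_ne_one {G M : Type*} [Group G] [MulOneClass M]
    (hcomm : ∀ a b : G, a * b = b * a) (η : G →* M) (hη : η ≠ 1) (h2 : ∃ z : G, z * z ≠ 1) :
    ∃ z₀ : G, η z₀ ≠ 1 ∧ z₀ * z₀ ≠ 1 := by
  by_contra hcon
  push Not at hcon
  obtain ⟨z₁, hz₁⟩ : ∃ z₁, η z₁ ≠ 1 := by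
    by_contra hall
    push Not at hall
    exact hη (MonoidHom.ext hall)
  obtain ⟨z, hz⟩ := h2
  refine hz ?_
  by_cases hηz : η z = 1
  · have h1 : η (z₁ * z) ≠ 1 := by rwa [map_mul, hηz, mul_one]
    have h3 : z₁ * z₁ = 1 := hcon z₁ hz₁
    have key : z₁ * z * (z₁ * z) = z₁ * z₁ * (z * z) := by
      rw [mul_assoc, ← mul_assoc z z₁ z, hcomm z z₁, mul_assoc, ← mul_assoc]
    calc z * z = z₁ * z₁ * (z * z) := by rw [h3, one_mul]
      _ = z₁ * z * (z₁ * z) := key.symm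
      _ = 1 := hcon _ h1
  · exact hcon z hηz

/-! ## §2 MAIN: `hNP` from the torus trace -/

-- two thirty-binder statements (hypothesis and conclusion): about 4× the default elaboration budget
set_option maxHeartbeats 1600000 in
/-- **RANK `1 × 1` NON-PERIODICITY FROM THE TORUS TRACE.**  The hypothesis `hNP` of the route-R wrapper
`rankOne_theta_twist_rigidity_of_nonPeriodic₁₁` — for every `1 × 1` Gram matrix `t`, non-split place `v`, section `s₁` of
`U(J₁)(F_v)` over `ι_v` with `ω_{s₁}` smooth and character `η₁` with open kernel: if the type set
`{ξ : Coinv_ξ(ω_{s₁}) ≠ 0}` (over unitary continuous `ξ`) is invariant under `ξ ↦ ξ · η₁` then `η₁ = 1` — stated in its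
EXACT text, follows from the finite-level character non-vanishing `hTR` (the text of `rankOne_torusTrace_ne_zero`):
`η₁ ≠ 1` gives `z₀` with `η₁ z₀ ≠ 1`, `z₀² ≠ 1` (§1 with `localPi_one_mul_comm` and the torus element off `{±1}` of `exists_mul_self_ne_one`); at the
level `K := K₀ ⊓ ker η₁` (`K₀` from `hTR` at `z₀`) the trace of `ω_{s₁}(z₀)` on the finite-dimensional
(`isAdmissible_weil_localPi_of_isField`) `ω_{s₁}(z₀)`-stable space `Fix_K` is `≠ 0` by `hTR` and `= 0` by the periodicity
of the multiplicity-free type set (`TwistedCoinv.trace_fixedPoints_eq_zero_of_coinv_periodic'` fed with (M1)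
`finiteDimensional_weightSpace_rankOne`). [cite: MoeglinVignerasWaldspurger1987, Chap. 2 II.8 and Chap. 3 §IV.4 Théorème principal 1) a)]
[cite: BernsteinZelevinsky1976, §2.1–2.3] -/
theorem nonPeriodic₁₁_of_torusTrace
    (hTR : ∀ (F : Type) [Field F] [NumberField F] (E : Type) [Field E] [NumberField E] [Algebra F E]
      [Algebra.IsQuadraticExtension F E] (c : E ≃ₐ[F] E) (δ : E) (hcδ : c δ = -δ) (hδ : δ ≠ 0) (d : F)
      (hd : δ * δ = algebraMap F E d) (t : Matrix (Fin 1) (Fin 1) F) (ht : t.IsSymm) (htd : IsUnit t.det)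
      (J₁ : Matrix (Fin 1) (Fin 1) E) (hJ₁ : J₁ = t.map (algebraMap F E)) (v : HeightOneSpectrum (𝓞 F))
      (hE : IsField (UnitaryGroup.LocalRing E v))
      (s₁ : UnitaryGroup.localPi E c 1 J₁ v →* LocalMp F 1 t v)
      (hs₁ : ∀ g, MpPsi.proj _ (s₁ g) = iota F E c 1 hcδ hδ hd t ht hJ₁ v g)
      (hsm₁ : Representation.IsSmooth ((MpPsi.toRep (localSchrodinger F 1 t v)).comp s₁))
      (z₀ : UnitaryGroup.localPi E c 1 J₁ v) (hz₀ : z₀ * z₀ ≠ 1),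
      ∃ K₀ : Subgroup (UnitaryGroup.localPi E c 1 J₁ v), IsOpen (K₀ : Set (UnitaryGroup.localPi E c 1 J₁ v)) ∧
        ∀ K : Subgroup (UnitaryGroup.localPi E c 1 J₁ v), IsOpen (K : Set (UnitaryGroup.localPi E c 1 J₁ v)) → K ≤ K₀ →
          ∀ (W : Submodule ℂ (SchwartzBruhat (Fin 1 → v.adicCompletion F))) [FiniteDimensional ℂ W],
            (∀ f, f ∈ W ↔ ∀ k ∈ K, ((MpPsi.toRep (localSchrodinger F 1 t v)).comp s₁) k f = f) →
            ∀ hW : ∀ w ∈ W, ((MpPsi.toRep (localSchrodinger F 1 t v)).comp s₁) z₀ w ∈ W,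
              LinearMap.trace ℂ W ((((MpPsi.toRep (localSchrodinger F 1 t v)).comp s₁) z₀).restrict hW) ≠ 0) :
    ∀ (F : Type) [Field F] [NumberField F] (E : Type) [Field E] [NumberField E] [Algebra F E]
      [Algebra.IsQuadraticExtension F E] (c : E ≃ₐ[F] E) (δ : E) (hcδ : c δ = -δ) (hδ : δ ≠ 0) (d : F)
      (hd : δ * δ = algebraMap F E d) (t : Matrix (Fin 1) (Fin 1) F) (ht : t.IsSymm) (_htd : IsUnit t.det)
      (J₁ : Matrix (Fin 1) (Fin 1) E) (hJ₁ : J₁ = t.map (algebraMap F E)) (v : HeightOneSpectrum (𝓞 F))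
      (_hE : IsField (UnitaryGroup.LocalRing E v))
      (s₁ : localPi E c 1 J₁ v →* LocalMp F 1 t v)
      (_hs₁ : ∀ g, MpPsi.proj _ (s₁ g) = iota F E c 1 hcδ hδ hd t ht hJ₁ v g)
      (_hsm₁ : Representation.IsSmooth ((MpPsi.toRep (localSchrodinger F 1 t v)).comp s₁))
      (η₁ : localPi E c 1 J₁ v →* ℂˣ)
      (_hη₁ : IsOpen ((η₁.ker : Subgroup (localPi E c 1 J₁ v)) : Set (localPi E c 1 J₁ v))),
      (∀ (ξ : localPi E c 1 J₁ v →* ℂˣ), (∀ u, ‖((ξ u : ℂˣ) : ℂ)‖ = 1) → (Continuous fun u => ((ξ u : ℂˣ) : ℂ)) →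
        (Nontrivial (TwistedCoinv.Coinv ((MpPsi.toRep (localSchrodinger F 1 t v)).comp s₁) ξ) ↔
          Nontrivial (TwistedCoinv.Coinv ((MpPsi.toRep (localSchrodinger F 1 t v)).comp s₁) (ξ * η₁)))) →
      η₁ = 1 := by
  intro F _ _ E _ _ _ _ c δ hcδ hδ d hd t ht htd J₁ hJ₁ v hE s₁ hs₁ hsm₁ η₁ hη₁ hper
  by_contra hne
  haveI : CompactSpace (localPi E c 1 J₁ v) := compactSpace_localPi_rankOne F E c hcδ hδ htd hJ₁ v hE
  set ω : Representation ℂ (localPi E c 1 J₁ v) (SchwartzBruhat (Fin 1 → v.adicCompletion F)) :=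
    (MpPsi.toRep (localSchrodinger F 1 t v)).comp s₁ with hω
  -- the test element `z₀`: `η₁ z₀ ≠ 1` and `z₀² ≠ 1`
  obtain ⟨z₀, hηz₀, hz₀⟩ := exists_map_ne_one_and_mul_self_ne_one (localPi_one_mul_comm E c J₁ v) η₁ hne
    (exists_mul_self_ne_one F E c hcδ hδ J₁ v)
  -- the level `K₀` of `hTR` at `z₀`, cut down by `ker η₁`
  obtain ⟨K₀, hK₀o, hK₀⟩ := hTR F E c δ hcδ hδ d hd t ht htd J₁ hJ₁ v hE s₁ hs₁ hsm₁ z₀ hz₀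
  set K : Subgroup (localPi E c 1 J₁ v) := K₀ ⊓ η₁.ker with hK
  have hKo : IsOpen (K : Set (localPi E c 1 J₁ v)) := hK₀o.inter hη₁
  -- `Fix_K(ω_{s₁})`: finite-dimensional (admissibility at the non-split place) and `ω_{s₁}(z₀)`-stable (commutativity)
  haveI : FiniteDimensional ℂ ↥(ω.fixedPoints K) :=
    (isAdmissible_weil_localPi_of_isField F E c 1 δ hcδ hδ d hd t ht htd J₁ hJ₁ v hE s₁ hs₁ hsm₁).finite_fixedPoints
      ⟨K, hKo⟩ (Subgroup.isClosed_of_isOpen K hKo).isCompact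
  have hW : ∀ w ∈ ω.fixedPoints K, ω z₀ w ∈ ω.fixedPoints K := by
    intro w hw
    rw [Representation.mem_fixedPoints] at hw ⊢
    intro k hk
    rw [← Module.End.mul_apply, ← map_mul, localPi_one_mul_comm E c J₁ v k z₀, map_mul, Module.End.mul_apply, hw k hk]
  -- `tr(ω_{s₁}(z₀) | Fix_K) ≠ 0` (TR) versus `= 0` (periodic multiplicity-free type set)
  exact hK₀ K hKo inf_le_left (ω.fixedPoints K) (fun f => ω.mem_fixedPoints K f) hW
    (TwistedCoinv.trace_fixedPoints_eq_zero_of_coinv_periodic' ω hsm₁ (localPi_one_mul_comm E c J₁ v)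
      (finiteDimensional_weightSpace_rankOne F E c hcδ hδ hd ht htd hJ₁ v hE s₁ hs₁ hsm₁) η₁ hper K hKo inf_le_right
      z₀ hηz₀ hW)

/-! ## §3 Row IV-4(c3) from the torus trace and the route-R frame inputs -/

-- three thirty-binder hypotheses: about 4× the default elaboration budget
set_option maxHeartbeats 1600000 in
/-- **ROW IV-4(c3) FROM THE TORUS TRACE** — `rankOne_theta_twist_rigidity` (two splittings of `U(J)(F_v)` over `ι_v`
with isomorphic non-zero rank-one theta lifts are equal, `J = T ⊗ 1` of rank `3`, `v` non-split) follows from the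
finite-level character non-vanishing `hTR` (text of `rankOne_torusTrace_ne_zero`) and the two route-R frame inputs of the
wrapper `rankOne_theta_twist_rigidity_of_nonPeriodic₁₁`: `hframe` (invariance of one-section twist rigidity under a
rational change of frame, text verbatim) and `hblock` (twist rigidity at a block frame modulo non-periodicity of the line
block, text verbatim = `twistRigid_block_of_nonPeriodic` up to binder order) — by that wrapper at
`hNP := nonPeriodic₁₁_of_torusTrace hTR`. [cite: MoeglinVignerasWaldspurger1987, Chap. 3 IV.4 and Chap. 2 II.1 Rem. (6), II Remarque (3)]
[cite: Liu2021, App. D Lemma D.1 (3)] -/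
theorem rankOne_theta_twist_rigidity_of_torusTrace
    (hTR : ∀ (F : Type) [Field F] [NumberField F] (E : Type) [Field E] [NumberField E] [Algebra F E]
      [Algebra.IsQuadraticExtension F E] (c : E ≃ₐ[F] E) (δ : E) (hcδ : c δ = -δ) (hδ : δ ≠ 0) (d : F)
      (hd : δ * δ = algebraMap F E d) (t : Matrix (Fin 1) (Fin 1) F) (ht : t.IsSymm) (htd : IsUnit t.det)
      (J₁ : Matrix (Fin 1) (Fin 1) E) (hJ₁ : J₁ = t.map (algebraMap F E)) (v : HeightOneSpectrum (𝓞 F))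
      (hE : IsField (UnitaryGroup.LocalRing E v))
      (s₁ : UnitaryGroup.localPi E c 1 J₁ v →* LocalMp F 1 t v)
      (hs₁ : ∀ g, MpPsi.proj _ (s₁ g) = iota F E c 1 hcδ hδ hd t ht hJ₁ v g)
      (hsm₁ : Representation.IsSmooth ((MpPsi.toRep (localSchrodinger F 1 t v)).comp s₁))
      (z₀ : UnitaryGroup.localPi E c 1 J₁ v) (hz₀ : z₀ * z₀ ≠ 1),
      ∃ K₀ : Subgroup (UnitaryGroup.localPi E c 1 J₁ v), IsOpen (K₀ : Set (UnitaryGroup.localPi E c 1 J₁ v)) ∧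
        ∀ K : Subgroup (UnitaryGroup.localPi E c 1 J₁ v), IsOpen (K : Set (UnitaryGroup.localPi E c 1 J₁ v)) → K ≤ K₀ →
          ∀ (W : Submodule ℂ (SchwartzBruhat (Fin 1 → v.adicCompletion F))) [FiniteDimensional ℂ W],
            (∀ f, f ∈ W ↔ ∀ k ∈ K, ((MpPsi.toRep (localSchrodinger F 1 t v)).comp s₁) k f = f) →
            ∀ hW : ∀ w ∈ W, ((MpPsi.toRep (localSchrodinger F 1 t v)).comp s₁) z₀ w ∈ W,
              LinearMap.trace ℂ W ((((MpPsi.toRep (localSchrodinger F 1 t v)).comp s₁) z₀).restrict hW) ≠ 0)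
    (hframe : ∀ (F : Type) [Field F] [NumberField F] (E : Type) [Field E] [NumberField E] [Algebra F E]
      [Algebra.IsQuadraticExtension F E] (c : E ≃ₐ[F] E) (δ : E) (hcδ : c δ = -δ) (hδ : δ ≠ 0) (d : F)
      (hd : δ * δ = algebraMap F E d) (T T' : Matrix (Fin 3) (Fin 3) F) (hT : T.IsSymm) (hT' : T'.IsSymm)
      (_hTd : IsUnit T.det) (_hT'd : IsUnit T'.det)
      (J : Matrix (Fin 3) (Fin 3) E) (hJ : J = T.map (algebraMap F E))
      (J' : Matrix (Fin 3) (Fin 3) E) (hJ' : J' = T'.map (algebraMap F E))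
      (P : GL (Fin 3) F) (_hP : (P : Matrix (Fin 3) (Fin 3) F)ᵀ * T * (P : Matrix (Fin 3) (Fin 3) F) = T')
      (v : HeightOneSpectrum (𝓞 F)) (_hE : IsField (UnitaryGroup.LocalRing E v)),
      -- one-section twist rigidity at `(T', J', v)` …
      (∀ (s : localPi E c 3 J' v →* LocalMp F 3 T' v)
        (_hs : ∀ g, MpPsi.proj _ (s g) = iota F E c 3 hcδ hδ hd T' hT' hJ' v g)
        (_hsm : Representation.IsSmooth ((MpPsi.toRep (localSchrodinger F 3 T' v)).comp s))
        (η : localPi E c 3 J' v →* ℂˣ) (_hη : IsOpen ((η.ker : Subgroup (localPi E c 3 J' v)) : Set (localPi E c 3 J' v)))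
        (J₁ : Matrix (Fin 1) (Fin 1) E) (hJ₁ : J₁ 0 0 ≠ 0) (χ χ' : localPi E c 1 J₁ v →* ℂˣ)
        (_hχu : ∀ z, ‖((χ z : ℂˣ) : ℂ)‖ = 1) (_hχc : Continuous fun z => ((χ z : ℂˣ) : ℂ))
        (_hχ'u : ∀ z, ‖((χ' z : ℂˣ) : ℂ)‖ = 1) (_hχ'c : Continuous fun z => ((χ' z : ℂˣ) : ℂ))
        (_hnt : Nontrivial (TwistedCoinv.Coinv
          ((show Representation ℂ (localPi E c 1 J₁ v) (SchwartzBruhat (Fin 3 → v.adicCompletion F)) from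
            ((MpPsi.toRep (localSchrodinger F 3 T' v)).comp s).comp (localCenter E c 3 J' J₁ hJ₁ v))) χ))
        (_hiso : AreIsomorphicRep
          (TwistedCoinv.rep
            (ρW := show Representation ℂ (localPi E c 1 J₁ v) (SchwartzBruhat (Fin 3 → v.adicCompletion F)) from
              ((MpPsi.toRep (localSchrodinger F 3 T' v)).comp s).comp (localCenter E c 3 J' J₁ hJ₁ v))
            χ ((MpPsi.toRep (localSchrodinger F 3 T' v)).comp s)
            (fun g z => (show Commute g (localCenter E c 3 J' J₁ hJ₁ v z) from
              localCenter_comm E c 3 J' J₁ hJ₁ v z g).map ((MpPsi.toRep (localSchrodinger F 3 T' v)).comp s)))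
          (SeesawScalar.twist η (TwistedCoinv.rep
            (ρW := show Representation ℂ (localPi E c 1 J₁ v) (SchwartzBruhat (Fin 3 → v.adicCompletion F)) from
              ((MpPsi.toRep (localSchrodinger F 3 T' v)).comp s).comp (localCenter E c 3 J' J₁ hJ₁ v))
            χ' ((MpPsi.toRep (localSchrodinger F 3 T' v)).comp s)
            (fun g z => (show Commute g (localCenter E c 3 J' J₁ hJ₁ v z) from
              localCenter_comm E c 3 J' J₁ hJ₁ v z g).map ((MpPsi.toRep (localSchrodinger F 3 T' v)).comp s))))),
        η = 1) →
      -- … implies one-section twist rigidity at `(T, J, v)`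
      ∀ (s : localPi E c 3 J v →* LocalMp F 3 T v)
        (_hs : ∀ g, MpPsi.proj _ (s g) = iota F E c 3 hcδ hδ hd T hT hJ v g)
        (_hsm : Representation.IsSmooth ((MpPsi.toRep (localSchrodinger F 3 T v)).comp s))
        (η : localPi E c 3 J v →* ℂˣ) (_hη : IsOpen ((η.ker : Subgroup (localPi E c 3 J v)) : Set (localPi E c 3 J v)))
        (J₁ : Matrix (Fin 1) (Fin 1) E) (hJ₁ : J₁ 0 0 ≠ 0) (χ χ' : localPi E c 1 J₁ v →* ℂˣ)
        (_hχu : ∀ z, ‖((χ z : ℂˣ) : ℂ)‖ = 1) (_hχc : Continuous fun z => ((χ z : ℂˣ) : ℂ))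
        (_hχ'u : ∀ z, ‖((χ' z : ℂˣ) : ℂ)‖ = 1) (_hχ'c : Continuous fun z => ((χ' z : ℂˣ) : ℂ))
        (_hnt : Nontrivial (TwistedCoinv.Coinv
          ((show Representation ℂ (localPi E c 1 J₁ v) (SchwartzBruhat (Fin 3 → v.adicCompletion F)) from
            ((MpPsi.toRep (localSchrodinger F 3 T v)).comp s).comp (localCenter E c 3 J J₁ hJ₁ v))) χ))
        (_hiso : AreIsomorphicRep
          (TwistedCoinv.rep
            (ρW := show Representation ℂ (localPi E c 1 J₁ v) (SchwartzBruhat (Fin 3 → v.adicCompletion F)) from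
              ((MpPsi.toRep (localSchrodinger F 3 T v)).comp s).comp (localCenter E c 3 J J₁ hJ₁ v))
            χ ((MpPsi.toRep (localSchrodinger F 3 T v)).comp s)
            (fun g z => (show Commute g (localCenter E c 3 J J₁ hJ₁ v z) from
              localCenter_comm E c 3 J J₁ hJ₁ v z g).map ((MpPsi.toRep (localSchrodinger F 3 T v)).comp s)))
          (SeesawScalar.twist η (TwistedCoinv.rep
            (ρW := show Representation ℂ (localPi E c 1 J₁ v) (SchwartzBruhat (Fin 3 → v.adicCompletion F)) from
              ((MpPsi.toRep (localSchrodinger F 3 T v)).comp s).comp (localCenter E c 3 J J₁ hJ₁ v))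
            χ' ((MpPsi.toRep (localSchrodinger F 3 T v)).comp s)
            (fun g z => (show Commute g (localCenter E c 3 J J₁ hJ₁ v z) from
              localCenter_comm E c 3 J J₁ hJ₁ v z g).map ((MpPsi.toRep (localSchrodinger F 3 T v)).comp s))))),
        η = 1)
    (hblock : ∀ (F : Type) [Field F] [NumberField F] (E : Type) [Field E] [NumberField E] [Algebra F E]
      [Algebra.IsQuadraticExtension F E] (c : E ≃ₐ[F] E) (δ : E) (hcδ : c δ = -δ) (hδ : δ ≠ 0) (d : F)
      (hd : δ * δ = algebraMap F E d) (v : HeightOneSpectrum (𝓞 F))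
      (t : Matrix (Fin 1) (Fin 1) F) (T₂ : Matrix (Fin 2) (Fin 2) F) (ht : t.IsSymm) (hT₂ : T₂.IsSymm)
      (_htd : IsUnit t.det) (hT₂d : IsUnit T₂.det)
      (J₁ : Matrix (Fin 1) (Fin 1) E) (hJ₁ : J₁ = t.map (algebraMap F E))
      (J₂ : Matrix (Fin 2) (Fin 2) E) (_hJ₂ : J₂ = T₂.map (algebraMap F E))
      (J : Matrix (Fin (1 + 2)) (Fin (1 + 2)) E) (hJ : J = (UnitaryGroup.finSum 1 2 t T₂).map (algebraMap F E))
      (s : localPi E c (1 + 2) J v →* LocalMp F (1 + 2) (UnitaryGroup.finSum 1 2 t T₂) v)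
      (hs : ∀ g, MpPsi.proj _ (s g) =
        iota F E c (1 + 2) hcδ hδ hd (UnitaryGroup.finSum 1 2 t T₂) (UnitaryGroup.isSymm_finSum ht hT₂) hJ v g)
      (J' : Matrix (Fin 1) (Fin 1) E) (hJ' : J' 0 0 ≠ 0)
      (_hE : IsField (UnitaryGroup.LocalRing E v))
      (_hsm : Representation.IsSmooth ((MpPsi.toRep (localSchrodinger F (1 + 2) (UnitaryGroup.finSum 1 2 t T₂) v)).comp s))
      (hJ₂h : (J₂.map c)ᵀ = J₂) (hJ₂det : J₂.det ≠ 0)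
      (_hiso₂ : LemD1.IsIsotropic (LemD1OfPlace.standingData E v c 2 J₂ hcδ hδ (le_refl 2) hJ₂h hJ₂det))
      (_hNP : ∀ (η₁ : localPi E c 1 J₁ v →* ℂˣ),
        IsOpen ((η₁.ker : Subgroup (localPi E c 1 J₁ v)) : Set (localPi E c 1 J₁ v)) →
        (∀ (ξ : localPi E c 1 J₁ v →* ℂˣ), (∀ u, ‖((ξ u : ℂˣ) : ℂ)‖ = 1) → (Continuous fun u => ((ξ u : ℂˣ) : ℂ)) →
          (Nontrivial (TwistedCoinv.Coinv ((MpPsi.toRep (localSchrodinger F 1 t v)).comp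
              (restrictLeft F E c v 1 2 hJ₁ hJ hcδ hδ hd ht hT₂ hT₂d s hs)) ξ) ↔
            Nontrivial (TwistedCoinv.Coinv ((MpPsi.toRep (localSchrodinger F 1 t v)).comp
              (restrictLeft F E c v 1 2 hJ₁ hJ hcδ hδ hd ht hT₂ hT₂d s hs)) (ξ * η₁)))) → η₁ = 1)
      (η : localPi E c (1 + 2) J v →* ℂˣ)
      (_hη : IsOpen ((η.ker : Subgroup (localPi E c (1 + 2) J v)) : Set (localPi E c (1 + 2) J v)))
      (χ χ' : localPi E c 1 J' v →* ℂˣ) (_hχu : ∀ z, ‖((χ z : ℂˣ) : ℂ)‖ = 1)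
      (_hχc : Continuous fun z => ((χ z : ℂˣ) : ℂ))
      (_hχ'u : ∀ z, ‖((χ' z : ℂˣ) : ℂ)‖ = 1) (_hχ'c : Continuous fun z => ((χ' z : ℂˣ) : ℂ))
      (_hiso : AreIsomorphicRep
        (TwistedCoinv.rep
          (ρW := ((MpPsi.toRep (localSchrodinger F (1 + 2) (UnitaryGroup.finSum 1 2 t T₂) v)).comp s).comp
            (localCenter E c (1 + 2) J J' hJ' v))
          χ ((MpPsi.toRep (localSchrodinger F (1 + 2) (UnitaryGroup.finSum 1 2 t T₂) v)).comp s)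
          (fun g z => (show Commute g (localCenter E c (1 + 2) J J' hJ' v z) from
            localCenter_comm E c (1 + 2) J J' hJ' v z g).map
              ((MpPsi.toRep (localSchrodinger F (1 + 2) (UnitaryGroup.finSum 1 2 t T₂) v)).comp s)))
        (SeesawScalar.twist η (TwistedCoinv.rep
          (ρW := ((MpPsi.toRep (localSchrodinger F (1 + 2) (UnitaryGroup.finSum 1 2 t T₂) v)).comp s).comp
            (localCenter E c (1 + 2) J J' hJ' v))
          χ' ((MpPsi.toRep (localSchrodinger F (1 + 2) (UnitaryGroup.finSum 1 2 t T₂) v)).comp s)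
          (fun g z => (show Commute g (localCenter E c (1 + 2) J J' hJ' v z) from
            localCenter_comm E c (1 + 2) J J' hJ' v z g).map
              ((MpPsi.toRep (localSchrodinger F (1 + 2) (UnitaryGroup.finSum 1 2 t T₂) v)).comp s))))),
      η = 1) :
    rankOne_theta_twist_rigidity :=
  rankOne_theta_twist_rigidity_of_nonPeriodic₁₁ (nonPeriodic₁₁_of_torusTrace hTR) hframe hblock

end Literature.RepresentationTheory.MoeglinVignerasWaldspurger1987

end
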